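import Summits.HodgeConjecture.CorCM.Model.FourierSum
import Summits.HodgeConjecture.CorCM.Model.FourierIntertwineAdjoint
import Summits.HodgeConjecture.CorCM.Model.DiagonalDegree
import HarnessLib

/-!
# COR-CM model layer (row M22 `Fact_algDuality`): clause (ii) AT THE SOCKET `Model.fourierSum`

Cell `pub-hodgecm2` (COR-CM), seat `b22` (clause (ii) of row M22, ROSTER v3.3).  HONEST FRAMING: bookkeeping
over landed theorems; no case of the Hodge conjecture and nothing about algebraic cycles is asserted.

The M22 interface (model-1, INBOX 19:10:29Z) fixes the Fourier-type operator of kernel K-a as the tree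
definition `Model.fourierSum hX b y i h : Hʲ(X(ℂ); ℚ) →ₗ H^i(X(ℂ); ℚ)`,
`fourierSum hX b y i h z = Σ_{c : Fin i → Fin N} tr_X(z ∪ m_i(b ∘ c)) • m_i(y ∘ c)` (`CorCM/Model/FourierSum.lean`).
Clause (ii) of `Fact_algDuality` asks for `Mb^* ∘ D ∘ Ma^* = N_{K/ℚ}(a)⁴ • D` for `D = fourierSum …`, `Ma`, `Mb`
acting diagonally by `a`, `ā` on the corner product.  This file states it LITERALLY at the socket:

* `pull_comp_fourierSum_comp_pull_eq_smul` — for any smooth projective `X`, morphisms `F G : X ⟶ X`, a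
  scalar `λ` with `tr_X ∘ F^* = λ • tr_X` on `H^{2 dim}` and families `b y` of degree-one classes satisfying
  the ADJOINT (Rosati) tensor identity `Σ_a F^* b_a ⊗ y_a = Σ_a b_a ⊗ G^* y_a` in `H¹ ⊗ H¹`:
  `pull G i ∘ₗ fourierSum hX b y i h ∘ₗ pull F j = λ • fourierSum hX b y i h`
  (the generic intertwining identity `map_fourierSum_map_eq_smul` of `CorCM/Model/FourierIntertwine.lean`,
  b22, in the adjoint/operator form `comp_comp_eq_smul_of_adjoint` of `CorCM/Model/FourierIntertwineAdjoint.lean`,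
  b23, instantiated at `D := fourierSum`, `τ := BettiUniverse.tr hX (2n)`);
* `var_pull_comp_fourierSum_comp_pull` — on the Picard–CM model: for the left-nested product `P` of the CM
  abelian varieties of four codes and `Ma : P ⟶ P` acting diagonally by `a ∈ K` (the binder block of
  `Model.var_deg_diag`, row M19: `d i` with `(d i)^* = ι_i(a)` on `H¹` and the four intertwinings
  `Ma^* ∘ prᵢ^* = prᵢ^* ∘ (d i)^*`), ANY `Mb : P ⟶ P` and families `b y` with
  `Σ_a Ma^* b_a ⊗ y_a = Σ_a b_a ⊗ Mb^* y_a`: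
  `pull Mb i ∘ₗ fourierSum hP b y i h ∘ₗ pull Ma j = N_{K/ℚ}(a)⁴ • fourierSum hP b y i h`
  — the exact shape of clause (ii) for `D := fourierSum hP b y 4 h` (`λ = N(a)⁴` is `var_deg_diag` at the top
  degree).  The adjoint identity is the R2 → P input (the Rosati condition of the `K`-balanced polarization,
  `CorCM/Model/RosatiTensor.lean` / `RosatiDualForm.lean`); no invertibility of `a` is needed (`a = 0` included).

References: Kleiman 1968 App. 2A (2A9–2A11); Mukai/Beauville `α̂^* ∘ 𝓕 ∘ α^* = deg(α) · 𝓕` (LNM 1016, Prop. 1).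
-/

noncomputable section

open scoped TensorProduct
open CategoryTheory MonoidalCategory CartesianMonoidalCategory
open Literature.AlgebraicTopology.SingularHomology
open Literature.AlgebraicGeometry.Motives (SchemeOver ComplexPoints IsSmoothProjective bettiCohomology AbelianVariety)
open Literature.AlgebraicGeometry.HodgeTheory
open Literature.NumberTheory.Automorphic.PicardCM

namespace Summit.HodgeConjecture.CorCM.Model

/-! ### Generic socket form -/

/-- **Clause (ii) at the socket, generic form.**  For a smooth projective `X/ℂ` of dimension `n`, morphisms
`F G : X ⟶ X`, a scalar `λ` with `tr_X ∘ F^* = λ • tr_X` on `H^{2n}(X(ℂ); ℚ)`, and families `b y : Fin N → H¹`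
with the adjoint tensor identity `Σ_a F^* b_a ⊗ y_a = Σ_a b_a ⊗ G^* y_a`, the Fourier-type operator satisfies
`G^* ∘ fourierSum hX b y i h ∘ F^* = λ • fourierSum hX b y i h`.
[cite: Kleiman1968AlgebraicCycles, Appendix 2A, 2A9–2A11] -/
theorem pull_comp_fourierSum_comp_pull_eq_smul {X : SchemeOver ℂ} {n : ℕ} (hX : IsSmoothProjective n X)
    (F G : X ⟶ X) (lam : ℚ)
    (hτ : BettiUniverse.tr hX (2 * n) ∘ₗ BettiUniverse.pull F (2 * n) = lam • BettiUniverse.tr hX (2 * n))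
    {N : ℕ} (b y : Fin N → bettiCohomology X 1)
    (hadj : ∑ a, BettiUniverse.pull F 1 (b a) ⊗ₜ[ℚ] y a = ∑ a, b a ⊗ₜ[ℚ] BettiUniverse.pull G 1 (y a))
    (i : ℕ) {j : ℕ} (h : j + i = 2 * n) :
    BettiUniverse.pull G i ∘ₗ fourierSum hX b y i h ∘ₗ BettiUniverse.pull F j = lam • fourierSum hX b y i h :=
  comp_comp_eq_smul_of_adjoint h (BettiUniverse.tr hX (2 * n))
    (Literature.AlgebraicGeometry.Motives.AlgPoints.mapContinuous (L := ℂ) F)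
    (Literature.AlgebraicGeometry.Motives.AlgPoints.mapContinuous (L := ℂ) G) lam hτ b y hadj
    (fourierSum hX b y i h) (fourierSum_apply hX b y i h)

/-- Element form of `pull_comp_fourierSum_comp_pull_eq_smul`. [cite: Kleiman1968AlgebraicCycles, Appendix 2A, 2A9–2A11] -/
theorem pull_fourierSum_pull_eq_smul {X : SchemeOver ℂ} {n : ℕ} (hX : IsSmoothProjective n X)
    (F G : X ⟶ X) (lam : ℚ)
    (hτ : BettiUniverse.tr hX (2 * n) ∘ₗ BettiUniverse.pull F (2 * n) = lam • BettiUniverse.tr hX (2 * n))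
    {N : ℕ} (b y : Fin N → bettiCohomology X 1)
    (hadj : ∑ a, BettiUniverse.pull F 1 (b a) ⊗ₜ[ℚ] y a = ∑ a, b a ⊗ₜ[ℚ] BettiUniverse.pull G 1 (y a))
    (i : ℕ) {j : ℕ} (h : j + i = 2 * n) (z : bettiCohomology X j) :
    BettiUniverse.pull G i (fourierSum hX b y i h (BettiUniverse.pull F j z)) = lam • fourierSum hX b y i h z := by
  have e := LinearMap.congr_fun (pull_comp_fourierSum_comp_pull_eq_smul hX F G lam hτ b y hadj i h) z
  simpa only [LinearMap.coe_comp, Function.comp_apply, LinearMap.smul_apply] using e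

/-! ### The package shape on `PicardCM.Var` (row M22, clause (ii)) -/

section PicardCMVar

/-- **Clause (ii) of `Fact_algDuality` for the model universe, at the socket.**  For the left-nested product
`P` of the CM abelian varieties `Var.cm (c i)` of four codes, a morphism `Ma : P ⟶ P` acting diagonally by
`a ∈ K` (hypotheses `d`, `hd`, `hM₀`–`hM₃` exactly as in row M19's `Model.var_deg_diag`: the package's
`IsDiagAct K Φ a Ma` at `k = 1`, `pr4` unfolded), ANY morphism `Mb : P ⟶ P`, and families `b y` of degree-one
classes with the adjoint (Rosati) tensor identity `Σ_a Ma^* b_a ⊗ y_a = Σ_a b_a ⊗ Mb^* y_a`: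
`Mb^* ∘ fourierSum hP b y i h ∘ Ma^* = N_{K/ℚ}(a)⁴ • fourierSum hP b y i h` (`var_deg_diag` at the top degree
`2 dim P` supplies `tr ∘ Ma^* = N(a)⁴ • tr`).  With `i = 4`, `j = 2 (dim P - 2)` this is clause (ii) verbatim for
`D := fourierSum hP b y 4 h`. [cite: Kleiman1968AlgebraicCycles, Appendix 2A, 2A9–2A11] -/
theorem var_pull_comp_fourierSum_comp_pull (hHD : exists_isReal_hodgeModel) (hI : hodgePQ_independent_of_hodgeModel)
    (hU : BallQuotientUniformisedDatum) (h₃ : CMAbelianVarietyRealised) (c : Fin 4 → CMCode) {K : Type} [Field K]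
    [NumberField K]
    (e : (i : Fin 4) → (K ≃+* (c i).E)) (a : K)
    (Ma Mb : Var.Mor hU h₃ (Var.prod (Var.prod (Var.prod (.cm (c 0)) (.cm (c 1))) (.cm (c 2))) (.cm (c 3)))
      (Var.prod (Var.prod (Var.prod (.cm (c 0)) (.cm (c 1))) (.cm (c 2))) (.cm (c 3))))
    (d : (i : Fin 4) → Var.Mor hU h₃ (.cm (c i)) (.cm (c i)))
    (hd : ∀ i, BettiUniverse.pull (d i) 1 =
      (BettiUniverse.cmEndAction ((cmRealisation h₃ (c i)).θ.comp (e i).toRingHom)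
        ((cmRealisation h₃ (c i)).exists_map_comp (e i)) hHD hI (Var.isSmoothProjective hU h₃ (.cm (c i)))).ι a)
    (hM₀ : BettiUniverse.pull Ma 1 ∘ₗ
        BettiUniverse.pull (Var.comp hU h₃ (Var.fst hU h₃ _ (.cm (c 3)))
          (Var.comp hU h₃ (Var.fst hU h₃ _ (.cm (c 2))) (Var.fst hU h₃ (.cm (c 0)) (.cm (c 1))))) 1 =
      BettiUniverse.pull (Var.comp hU h₃ (Var.fst hU h₃ _ (.cm (c 3)))
          (Var.comp hU h₃ (Var.fst hU h₃ _ (.cm (c 2))) (Var.fst hU h₃ (.cm (c 0)) (.cm (c 1))))) 1 ∘ₗ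
        BettiUniverse.pull (d 0) 1)
    (hM₁ : BettiUniverse.pull Ma 1 ∘ₗ
        BettiUniverse.pull (Var.comp hU h₃ (Var.fst hU h₃ _ (.cm (c 3)))
          (Var.comp hU h₃ (Var.fst hU h₃ _ (.cm (c 2))) (Var.snd hU h₃ (.cm (c 0)) (.cm (c 1))))) 1 =
      BettiUniverse.pull (Var.comp hU h₃ (Var.fst hU h₃ _ (.cm (c 3)))
          (Var.comp hU h₃ (Var.fst hU h₃ _ (.cm (c 2))) (Var.snd hU h₃ (.cm (c 0)) (.cm (c 1))))) 1 ∘ₗ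
        BettiUniverse.pull (d 1) 1)
    (hM₂ : BettiUniverse.pull Ma 1 ∘ₗ
        BettiUniverse.pull (Var.comp hU h₃ (Var.fst hU h₃ _ (.cm (c 3))) (Var.snd hU h₃ _ (.cm (c 2)))) 1 =
      BettiUniverse.pull (Var.comp hU h₃ (Var.fst hU h₃ _ (.cm (c 3))) (Var.snd hU h₃ _ (.cm (c 2)))) 1 ∘ₗ
        BettiUniverse.pull (d 2) 1)
    (hM₃ : BettiUniverse.pull Ma 1 ∘ₗ BettiUniverse.pull (Var.snd hU h₃ _ (.cm (c 3))) 1 =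
      BettiUniverse.pull (Var.snd hU h₃ _ (.cm (c 3))) 1 ∘ₗ BettiUniverse.pull (d 3) 1)
    {N : ℕ} (b y : Fin N → Var.Coh hU h₃
      (Var.prod (Var.prod (Var.prod (.cm (c 0)) (.cm (c 1))) (.cm (c 2))) (.cm (c 3))) 1)
    (hadj : ∑ q, BettiUniverse.pull Ma 1 (b q) ⊗ₜ[ℚ] y q = ∑ q, b q ⊗ₜ[ℚ] BettiUniverse.pull Mb 1 (y q))
    (i : ℕ) {j : ℕ}
    (h : j + i = 2 * Var.dim (Var.prod (Var.prod (Var.prod (.cm (c 0)) (.cm (c 1))) (.cm (c 2))) (.cm (c 3)))) :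
    BettiUniverse.pull Mb i ∘ₗ
        fourierSum (Var.isSmoothProjective hU h₃
          (Var.prod (Var.prod (Var.prod (.cm (c 0)) (.cm (c 1))) (.cm (c 2))) (.cm (c 3)))) b y i h ∘ₗ
        BettiUniverse.pull Ma j =
      ((Algebra.norm ℚ a) ^ 4) •
        fourierSum (Var.isSmoothProjective hU h₃
          (Var.prod (Var.prod (Var.prod (.cm (c 0)) (.cm (c 1))) (.cm (c 2))) (.cm (c 3)))) b y i h :=
  pull_comp_fourierSum_comp_pull_eq_smul _ Ma Mb _
    (var_deg_diag hHD hI hU h₃ c e a Ma d hd hM₀ hM₁ hM₂ hM₃ _) b y hadj i h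

end PicardCMVar

end Summit.HodgeConjecture.CorCM.Model

end
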